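import Literature.NumberTheory.EllipticCurves.PastenHeightBounds
import Literature.NumberTheory.EllipticCurves.NewformDistinguishingPrimeGRH
import HarnessLib

/-!
# Pasten's Shimura-curve height bound under GRH: `h(E) < (ε + 1/24) φ(D) M log log N`
# (Pasten 2024, Thm 7.7, GRH clauses)

Topic `Literature/NumberTheory/EllipticCurves` (family `abc`, LADDER-ABC A1, the *modular method*;
cross-ladder literature-typing seat lit-abc-pasten g5). ONE named fact (`def … : Prop`, D-0014), the
GRH clauses of

* H. Pasten, *Shimura curves and the abc conjecture*, J. Number Theory **254** (2024) 214–335 =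
  arXiv:1705.09251v4 [`PastenShimura2024`], **Theorem 7.7** (arXiv §7.5, p. 27; held TeX read):

  > For `ε > 0` and `N ≫_ε 1` (with an effective implicit constant), for each admissible
  > factorization `N = DM` we have the following bounds valid for all elliptic curves `E` over `ℚ`
  > with conductor `N`: `h(E) < (ε + 1/24) φ(D) M log log N` (under GRH) … and similarly
  > `log|Δ_E| < (ε + 1/2) φ(D) M log log N` (under GRH).

  "Under GRH" is the hypothesis of Thm 7.4 (p. 27): *"Suppose that the Generalized Riemann Hypothesis
  for Rankin–Selberg `L`-functions of modular forms holds"*; the proof (Thm 7.4 via Thm 7.3 =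
  Iwaniec–Kowalski Prop. 5.22) uses it for the pairs `L(s, f ⊗ f)`, `L(s, f ⊗ g)` of weight-`2`
  newforms corresponding by Jacquet–Langlands to the eigen-systems on `𝕋_{D,M}` (levels dividing `N`).

The unconditional clause of Thm 7.7 (`(ε + 1/48) φ(D) M log N`) is the hypothesis `h77` of the
tree's PROVED `pasten2024_height_lt_of_admissible_bound` (`PastenHeightBoundsProofs.lean`), and the
unconditional Thm 1.9 = Cor 7.8 is the named fact `pasten2024_height_lt` (`PastenHeightBounds.lean`),
whose docstring records "the GRH branch … is not vendored" — this file vendors it, at the level of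
Thm 7.7 (general admissible `D`), from which Cor 7.8's GRH branch and the `abc` consequence
`log c ≪ φ(rad) · log log rad` (GRH) are PROVED in the companion `PastenHeightBoundsGRHProofs.lean`.
At `D = 1` the statement is the GRH clause of Thm 7.5, PROVED in the tree from
{modularity, Mazur–Kenku, Deligne, Thm 7.3} + GRH (`PastenShimura2024_thm_7_5_grh`,
`ModularDegreeGRHBoundProofs.lean`); for `D > 1` no carrier for `δ_{D,M}` bounds / `𝕋_{D,M}` exists,
whence a named fact.

Rendering (as `pasten2024_height_lt` and the `h77` shape): `E/ℚ` is a global minimal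
`W : WeierstrassCurve ℚ`, `h(E) = neronLatticeHeight L` for a Néron lattice `L` of `W`
(`IsNeronLatticeOf`), `N = W.conductorNorm ℤ`, `|Δ_E| = W.minimalDiscriminantNorm ℤ`; admissible
(§2 p. 12): `N = D M`, `D` squarefree with an even number of prime factors (possibly `D = 1`),
`gcd(D, M) = 1`; `φ = Nat.totient`; "`N ≫_ε 1`" as a threshold `N₀(ε)` (effectivity dropped); GRH as
the tree's `RankinSelbergGRH f g` (`:= IsNonvanishingOnRightHalf (rankinSelbergLSeries f g)`,
`NewformDistinguishingPrimeGRH.lean`) for ALL pairs of weight-`2` newforms (`IsNewform0`) — the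
ANTECEDENT of the fact; nothing about GRH is asserted.

## References

* [PastenShimura2024] H. Pasten, J. Number Theory 254 (2024) = arXiv:1705.09251v4: §2 p. 12
  (admissible factorizations), Thm 7.4 and Thm 7.7 (GRH clauses), Cor 7.8, arXiv p. 27.
* [IwaniecKowalski2004] H. Iwaniec, E. Kowalski, *Analytic Number Theory*, §5.7 and Prop. 5.22 (GRH
  for Rankin–Selberg `L`-functions; Pasten's Thm 7.3).
-/

noncomputable section

open scoped MatrixGroups ModularForm

open WeierstrassCurve IsDedekindDomain CongruenceSubgroup

namespace Literature.NumberTheory.EllipticCurves.ModularForms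

/-- **Pasten 2024, Theorem 7.7, GRH clauses.** Assuming GRH for the Rankin–Selberg `L`-functions
`L(s, f ⊗ g)` of all pairs of weight-`2` newforms (antecedent; `RankinSelbergGRH`): for every `ε > 0`
there is `N₀` such that for every elliptic curve `E/ℚ` (global minimal model `W`, Néron lattice `L`)
of conductor `N ≥ N₀` and every admissible factorization `N = D M`,
`h(E) < (ε + 1/24) φ(D) M log log N` and `log|Δ_E| < (ε + 1/2) φ(D) M log log N`.
Printed proof: Thm 7.6 (the Shimura curve approach, `h(E) < (1/2 + ε) log δ_{D,M}(E)`) with Thm 7.4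
(`log δ_{D,M} ≤ (1/12 + ε) φ(D) M log log N` under GRH, from Thm 5.5 on `𝕋_{D,M}`, Thm 7.3 and
Prop 7.1). Users take `(h : PastenShimura2024_thm_7_7_grh)`; Cor 7.8 (GRH) and the `abc` form are
proved from it in `PastenHeightBoundsGRHProofs.lean`.
[cite: PastenShimura2024, Thm 7.7 (GRH clauses; arXiv §7.5 p. 27) with Thm 7.4] -/
def PastenShimura2024_thm_7_7_grh : Prop :=
  (∀ (N₁ N₂ : ℕ) [NeZero N₁] [NeZero N₂] (f : CuspForm (Gamma0 N₁) 2) (g : CuspForm (Gamma0 N₂) 2),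
      IsNewform0 f → IsNewform0 g → RankinSelbergGRH f g) →
  ∀ ε : ℝ, 0 < ε → ∃ N₀ : ℕ,
    ∀ (W : WeierstrassCurve ℚ) [W.IsElliptic] [W.IsGloballyMinimal] (L : PeriodPair),
      IsNeronLatticeOf (W.baseChange ℂ) L →
      ∀ D M : ℕ, W.conductorNorm ℤ = D * M → Squarefree D → Even D.primeFactors.card →
        D.Coprime M → N₀ ≤ W.conductorNorm ℤ →
          neronLatticeHeight L <
              (ε + 1 / 24) * (Nat.totient D : ℝ) * (M : ℝ) *
                Real.log (Real.log (W.conductorNorm ℤ : ℝ)) ∧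
            Real.log (W.minimalDiscriminantNorm ℤ : ℝ) <
              (ε + 1 / 2) * (Nat.totient D : ℝ) * (M : ℝ) *
                Real.log (Real.log (W.conductorNorm ℤ : ℝ))

/-- **Thm 7.7 (GRH) at the trivial factorization `D = 1`, `M = N`** (`φ(1) · N = N`): under GRH,
for `ε > 0` and `N ≥ N₀(ε)`, `h(E) < (ε + 1/24) N log log N` and `log|Δ_E| < (ε + 1/2) N log log N`
— the GRH clause of Thm 7.5 ("if we assume GRH, for `N ≫_ε 1` …", p. 27), which the tree PROVES at
`D = 1` from {modularity, Mazur–Kenku, Deligne, Thm 7.3} (`PastenShimura2024_thm_7_5_grh`). PROVED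
projection of the named fact. [cite: PastenShimura2024, Thm 7.5 (GRH clause) and Thm 7.7 at D = 1, arXiv p. 27] -/
theorem PastenShimura2024_thm_7_7_grh.levelOne (h : PastenShimura2024_thm_7_7_grh)
    (hGRH : ∀ (N₁ N₂ : ℕ) [NeZero N₁] [NeZero N₂] (f : CuspForm (Gamma0 N₁) 2)
      (g : CuspForm (Gamma0 N₂) 2), IsNewform0 f → IsNewform0 g → RankinSelbergGRH f g)
    {ε : ℝ} (hε : 0 < ε) :
    ∃ N₀ : ℕ, ∀ (W : WeierstrassCurve ℚ) [W.IsElliptic] [W.IsGloballyMinimal] (L : PeriodPair),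
      IsNeronLatticeOf (W.baseChange ℂ) L → N₀ ≤ W.conductorNorm ℤ →
        neronLatticeHeight L <
            (ε + 1 / 24) * (W.conductorNorm ℤ : ℝ) * Real.log (Real.log (W.conductorNorm ℤ : ℝ)) ∧
          Real.log (W.minimalDiscriminantNorm ℤ : ℝ) <
            (ε + 1 / 2) * (W.conductorNorm ℤ : ℝ) * Real.log (Real.log (W.conductorNorm ℤ : ℝ)) := by
  obtain ⟨N₀, hN₀⟩ := h hGRH ε hε
  refine ⟨N₀, fun W _ _ L hL hN => ?_⟩
  have h1 := hN₀ W L hL 1 (W.conductorNorm ℤ) (by simp) squarefree_one (by simp)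
    (Nat.coprime_one_left _) hN
  simpa using h1

end Literature.NumberTheory.EllipticCurves.ModularForms

end
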